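import Literature.MathematicalPhysics.QuantumLattice.HubbardUVSymbolFrameShift
import Literature.MathematicalPhysics.QuantumLattice.HubbardUVSymbolCTDifferences
import Mathlib.Analysis.Calculus.MeanValue
import HarnessLib

/-!
# The frame-shift of the ultraviolet symbol with its DECAY IN THE BAND: `‖Ψ_{e₁}(ω) − Ψ_{e₀}(ω)‖ ≤ 4(2B₁+1)c·|e₁−e₀| / max(ω² + d², Λ²/4)`

Topic `MathematicalPhysics/QuantumLattice`; cell gate-hubbard-kl, located risk «(C)-B-REP» (KL STATUS 2026-08-27 (R59c)), item (γ).  The frame-SHIFT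
door `HubbardUVSymbolFrameShift.norm_uvSymbolFn_sub_le` (p524431) bounds `‖Ψ_e(ω) − Ψ_{e′}(ω)‖` by `(2B₁+1)c/max(|ω|,Λ/2)²·|e − e′|` — uniformly
in the band values, i.e. WITHOUT the decay of `∂_eΨ` away from the Fermi surface; summed over all ultraviolet modes this costs `Σ_k 1 = L²` per frequency and
produces the `β/Λ` of `…EngineFrameShiftResponse.sum_norm_uvSymbolCT_sub_le` (memo B-DOOR-LAW-p2g12 §2(b)).  Above the shell (`ω² + e² > Λ²`) the weight is
`1` and `∂_eΨ = −c/(−iω+e)²` decays like `c/(ω² + e²)`; on the shell the old bound is `≤ 4(2B₁+1)c/Λ²`; below it everything vanishes.  Hence: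

* `norm_uvSymbolFnXiD1_le_decay` — `‖Ψ̂′(e)‖ ≤ 4(2B₁+1)·c / max(ω² + e², Λ²/4)` everywhere;
* `norm_uvSymbolFnXi_sub_le_decay` / `norm_uvSymbolFn_sub_le_decay` — mean-value form on a band segment staying at distance `≥ d` from `e = 0`:
  `‖Ψ_{e₁}(ω) − Ψ_{e₀}(ω)‖ ≤ 4(2B₁+1)c·|e₁ − e₀| / max(ω² + d², Λ²/4)` with `d = max(|e₀| − |e₁ − e₀|, 0)`;
* `norm_uvSymbolCT_sub_le_decay` — the lattice instance: `‖Ψ_K − Ψ_{K′}‖((i,k⃗),σ) ≤ 4(2B₁+1)βL²·|K(p) − K′(p)| / max(ω_i² + d², Λ²/4)`,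
  `d = max(|e_K(k⃗)| − |K(p) − K′(p)|, 0)` — the per-mode input of the SHARP `ℓ¹` frame-shift bound (the `k⃗`-sum then gains the density of states).

Everything is proved; no definitions; no named facts.

## Sources

G. Benfatto, A. Giuliani, V. Mastropietro, Ann. Henri Poincaré 7 (2006) 809–898, §2.2 (2.23), (2.36aa) [`BenfattoGiulianiMastropietro2006`];
M. Salmhofer, *Renormalization* (1999), §4.2.5 (4.70)–(4.71) [`Salmhofer1999`].
-/

noncomputable section

namespace Literature.MathematicalPhysics.QuantumLattice

open Literature.Probability.LatticeModels

/-- **`‖Ψ̂′(e)‖ ≤ 4(2B₁+1)·c / max(ω² + e², Λ²/4)`** everywhere: the band derivative of the ultraviolet symbol decays like `(ω² + e²)⁻¹` above the shell.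
[cite: BenfattoGiulianiMastropietro2006, §2.2 (2.36aa)] -/
theorem norm_uvSymbolFnXiD1_le_decay {c Λ ω : ℝ} (hΛ : 0 < Λ) (hc : 0 ≤ c) {B₁ : ℝ} (hB₁ : ∀ x, |deriv salmhoferCutoff x| ≤ B₁) (e : ℝ) :
    ‖uvSymbolFnXiD1 c Λ ω e‖ ≤ 4 * ((2 * B₁ + 1) * c) / max (ω ^ 2 + e ^ 2) (Λ ^ 2 / 4) := by
  have hB10 : 0 ≤ B₁ := (abs_nonneg _).trans (hB₁ 0)
  have hK : 0 ≤ (2 * B₁ + 1) * c := by positivity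
  have hmax : 0 < max (ω ^ 2 + e ^ 2) (Λ ^ 2 / 4) := lt_max_of_lt_right (by positivity)
  by_cases hgt : Λ ^ 2 < e ^ 2 + ω ^ 2
  · -- above the shell: `W = 1`, `W′ = 0`, `Ψ̂′ = R′`
    obtain ⟨h0, h1, -⟩ := uvWeightFn_eq_one_of_gt hΛ (e := ω) (ω := e) hgt
    have hpos : 0 < ω ^ 2 + e ^ 2 := by nlinarith [sq_nonneg Λ]
    have hm : max (ω ^ 2 + e ^ 2) (Λ ^ 2 / 4) = ω ^ 2 + e ^ 2 := max_eq_left (by nlinarith)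
    rw [uvSymbolFnXiD1, h0, h1, Complex.ofReal_zero, Complex.ofReal_one, zero_mul, zero_add, one_mul, norm_resolventFnXiD1 hc,
      norm_sq_uvDen, hm, div_le_div_iff_of_pos_right hpos]
    nlinarith
  · -- on or below the shell: the envelope bound and `max(|ω|,Λ/2)² ≥ Λ²/4 ≥ max(ω²+e², Λ²/4)/4`
    have hle : e ^ 2 + ω ^ 2 ≤ Λ ^ 2 := not_lt.1 hgt
    have hm := uvEnv_pos hΛ ω
    have hmΛ : Λ / 2 ≤ max |ω| (Λ / 2) := le_max_right _ _
    have h1 := norm_uvSymbolFnXiD1_le (c := c) (ω := ω) hΛ hc hB₁ e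
    refine h1.trans ?_
    rw [div_le_div_iff₀ (by positivity) hmax]
    have hmaxle : max (ω ^ 2 + e ^ 2) (Λ ^ 2 / 4) ≤ Λ ^ 2 := max_le (by linarith) (by nlinarith)
    have hm2 : Λ ^ 2 / 4 ≤ max |ω| (Λ / 2) ^ 2 := by nlinarith
    calc (2 * B₁ + 1) * c * max (ω ^ 2 + e ^ 2) (Λ ^ 2 / 4) ≤ (2 * B₁ + 1) * c * Λ ^ 2 := mul_le_mul_of_nonneg_left hmaxle hK
      _ = 4 * ((2 * B₁ + 1) * c) * (Λ ^ 2 / 4) := by ring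
      _ ≤ 4 * ((2 * B₁ + 1) * c) * max |ω| (Λ / 2) ^ 2 := mul_le_mul_of_nonneg_left hm2 (by positivity)

/-- **Mean-value form with decay**: on a band segment `[e₀, e₁]` staying at distance `≥ d ≥ 0` from the Fermi surface,
`‖Ψ̂(e₁) − Ψ̂(e₀)‖ ≤ 4(2B₁+1)c / max(ω² + d², Λ²/4) · |e₁ − e₀|`. [cite: BenfattoGiulianiMastropietro2006, §2.2 (2.36aa)] -/
theorem norm_uvSymbolFnXi_sub_le_decay {c Λ ω : ℝ} (hΛ : 0 < Λ) (hc : 0 ≤ c) {B₁ : ℝ} (hB₁ : ∀ x, |deriv salmhoferCutoff x| ≤ B₁)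
    (e₀ e₁ : ℝ) {d : ℝ} (hd : 0 ≤ d) (hseg : ∀ e ∈ Set.uIcc e₀ e₁, d ≤ |e|) :
    ‖uvSymbolFnXi c Λ ω e₁ - uvSymbolFnXi c Λ ω e₀‖ ≤ 4 * ((2 * B₁ + 1) * c) / max (ω ^ 2 + d ^ 2) (Λ ^ 2 / 4) * |e₁ - e₀| := by
  have hB10 : 0 ≤ B₁ := (abs_nonneg _).trans (hB₁ 0)
  have hmaxd : 0 < max (ω ^ 2 + d ^ 2) (Λ ^ 2 / 4) := lt_max_of_lt_right (by positivity)
  have hbound : ∀ e ∈ Set.uIcc e₀ e₁, ‖uvSymbolFnXiD1 c Λ ω e‖ ≤ 4 * ((2 * B₁ + 1) * c) / max (ω ^ 2 + d ^ 2) (Λ ^ 2 / 4) := by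
    intro e he
    refine (norm_uvSymbolFnXiD1_le_decay hΛ hc hB₁ e).trans ?_
    have hde : d ^ 2 ≤ e ^ 2 := by
      have := hseg e he
      calc d ^ 2 ≤ |e| ^ 2 := pow_le_pow_left₀ hd this 2
        _ = e ^ 2 := sq_abs e
    exact div_le_div_of_nonneg_left (by positivity) hmaxd (max_le_max (by linarith) le_rfl)
  have h := Convex.norm_image_sub_le_of_norm_hasDerivWithin_le (f := uvSymbolFnXi c Λ ω) (f' := uvSymbolFnXiD1 c Λ ω)
    (s := Set.uIcc e₀ e₁) (fun x _ => (hasDerivAt_uvSymbolFnXi hΛ x).hasDerivWithinAt) hbound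
    (convex_uIcc e₀ e₁) Set.left_mem_uIcc Set.right_mem_uIcc
  rwa [Real.norm_eq_abs] at h

/-- On the segment `[e₀, e₁]` every band value is at distance `≥ |e₀| − |e₁ − e₀|` from the Fermi surface. [folklore] -/
private theorem abs_sub_abs_sub_le_abs_of_mem_uIcc {e₀ e₁ e : ℝ} (he : e ∈ Set.uIcc e₀ e₁) : |e₀| - |e₁ - e₀| ≤ |e| := by
  have h1 : |e - e₀| ≤ |e₁ - e₀| := Set.abs_sub_left_of_mem_uIcc he
  have h2 : |e₀| - |e - e₀| ≤ |e| := by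
    have := abs_sub_abs_le_abs_sub e₀ e
    rw [abs_sub_comm] at this
    linarith
  linarith

/-- **The decaying frame-shift bound, self-contained form**: `‖Ψ_{e₁}(ω) − Ψ_{e₀}(ω)‖ ≤ 4(2B₁+1)c·|e₁ − e₀| / max(ω² + d², Λ²/4)` with
`d = max(|e₀| − |e₁ − e₀|, 0)`. [cite: BenfattoGiulianiMastropietro2006, §2.2 (2.36aa)] -/
theorem norm_uvSymbolFn_sub_le_decay {c Λ : ℝ} (hΛ : 0 < Λ) (hc : 0 ≤ c) {B₁ : ℝ} (hB₁ : ∀ x, |deriv salmhoferCutoff x| ≤ B₁)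
    (ω e₀ e₁ : ℝ) :
    ‖uvSymbolFn c Λ e₁ ω - uvSymbolFn c Λ e₀ ω‖ ≤
      4 * ((2 * B₁ + 1) * c) / max (ω ^ 2 + (max (|e₀| - |e₁ - e₀|) 0) ^ 2) (Λ ^ 2 / 4) * |e₁ - e₀| := by
  rw [uvSymbolFn_eq_uvSymbolFnXi, uvSymbolFn_eq_uvSymbolFnXi]
  refine norm_uvSymbolFnXi_sub_le_decay hΛ hc hB₁ e₀ e₁ (le_max_right _ _) fun e he => ?_
  exact max_le (abs_sub_abs_sub_le_abs_of_mem_uIcc he) (abs_nonneg e)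

/-- **Lattice instance**: for two frames `K, K′`, at every kept frequency `ω_i`, lattice momentum `k⃗` and spin,
`‖Ψ_K − Ψ_{K′}‖((i,k⃗),σ) ≤ 4(2B₁+1)βL²·|K(p_k⃗) − K′(p_k⃗)| / max(ω_i² + d², Λ²/4)`, `d = max(|e_{K′}(k⃗)| − |K(p) − K′(p)|, 0)`
(`e_{K′} = nambuXiCT … K′`). [cite: BenfattoGiulianiMastropietro2006, §2.2 (2.36aa)] -/
theorem norm_uvSymbolCT_sub_le_decay {L M : ℕ} [NeZero L] {B₁ : ℝ} (hB₁ : ∀ y, |deriv salmhoferCutoff y| ≤ B₁) {β : ℝ} (hβ : 0 < β)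
    {Λ : ℝ} (hΛ : 0 < Λ) (μ : ℝ) (K K' : TrigPolyC4v) (i : MatsubaraIdx M) (kv : TorusSite 2 L) (σ : Fin 2) :
    ‖uvSymbolCT L M β μ K Λ ((i, kv), σ) - uvSymbolCT L M β μ K' Λ ((i, kv), σ)‖ ≤
      4 * ((2 * B₁ + 1) * (β * (L : ℝ) ^ 2)) /
          max (matsubaraFreq β M i ^ 2 +
            (max (|nambuXiCT L μ K' kv| - |K.eval (latticeMomentum L kv) - K'.eval (latticeMomentum L kv)|) 0) ^ 2) (Λ ^ 2 / 4) *
        |K.eval (latticeMomentum L kv) - K'.eval (latticeMomentum L kv)| := by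
  have hL : (0 : ℝ) < L := by exact_mod_cast NeZero.pos L
  rw [uvSymbolCT_eq_uvSymbolFn hβ, uvSymbolCT_eq_uvSymbolFn hβ]
  have h := norm_uvSymbolFn_sub_le_decay (c := β * (L : ℝ) ^ 2) hΛ (by positivity) hB₁ (matsubaraFreq β M i) (nambuXiCT L μ K' kv)
    (nambuXiCT L μ K kv)
  have he : nambuXiCT L μ K kv - nambuXiCT L μ K' kv = -(K.eval (latticeMomentum L kv) - K'.eval (latticeMomentum L kv)) := by
    rw [nambuXiCT, nambuXiCT]; ring
  rw [he, abs_neg] at h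
  exact h

end Literature.MathematicalPhysics.QuantumLattice

end
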